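import Summits.PneNP.PneNP.Theorems.SymmetryBudgetWindowBarrierEntropyGameColouring
import Literature.ModelTheory.FiniteModelTheory.WeisfeilerLemanColoured

/-!
# Discretising colourings identify: a checkable TAME certificate for the entropy game
(dichotomy `WindowBarrier` stmt-PneNP-2145 / `NoHiddenOrder` stmt-PneNP-14781, route `PneNP/SymmetryBudget`)

A graph `W` together with a vertex colouring `c` whose COLOUR REFINEMENT (1-dimensional Weisfeiler–Leman on
the coloured graph, `wlColourC W c T` on `1`-tuples `fun _ => v`, `Literature/…/WeisfeilerLemanColoured.lean`) is DISCRETE at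
some round is identified among coloured graphs by the colour-respecting bijective 2-pebble game (folklore;
Immerman–Lander 1990): the bijection Duplicator announces at the empty position preserves the refined colours,
hence is forced, hence is an isomorphism.  Combined with colouring robustness
(`CosetGame.colourRobust_of_entropyGame`): if `c` has entropy `≤ K n` then NO non-isomorphic `H` has an
entropy-`(K+1)` game against `W` (once `n ≥ 8`, so that `n / (log₂ n + 1) ≥ 2` pebbles are available).
So `(c, T)` is a certificate, checkable by running colour refinement, that `W` is not half of a witness
pair for `HardToIdentify` at level `K + 1` — the formal form of "Spoiler names a cheap colouring and refines".

* `CRIdent.update_tup1`, `CRIdent.wlColourC_eq_of_mem` — along a colour-respecting bijective `k`-pebble strategy (`k ≥ 2`), singly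
  pebbled pairs have equal colour-refinement colours at every round.
* **`CRIdent.nonempty_iso_of_strategy`** — if moreover the refinement of `(G, c)` is injective at some round,
  `G ≃g H`.
* **`CosetGame.nonempty_iso_of_entropyGame_of_discrete`**, **`CosetGame.not_nonempty_entropyGame_of_discrete`** —
  the entropy-game form: a colouring of entropy `≤ K n` with discrete refinement identifies `W` at entropy `K + 1`.
-/

-- `Summit.PneNP.PneNP.…` duplicates `PneNP` BY DESIGN (single-problem summit).
set_option linter.dupNamespace false

namespace Summit.PneNP.PneNP.Theorems

open Finset Filter Literature.Computability.Complexity Literature.ModelTheory.FiniteModelTheory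

/-! ### Colour refinement along a colour-respecting pebble strategy -/

namespace CRIdent

variable {V W κ : Type*} [Fintype V] [DecidableEq V] [Fintype W] [DecidableEq W]
  {G : SimpleGraph V} {H : SimpleGraph W} [DecidableRel G.Adj] [DecidableRel H.Adj] {c : V → κ} {d : W → κ}

/-- Substituting into a `1`-tuple replaces it. -/
theorem update_tup1 {α : Type*} (a w : α) (j : Fin 1) : Function.update (fun _ : Fin 1 => a) j w = (fun _ : Fin 1 => w) := by
  funext x
  have hx : x = j := Subsingleton.elim _ _
  subst hx
  simp

omit [Fintype V] [DecidableEq V] [Fintype W] [DecidableEq W] [DecidableRel G.Adj] [DecidableRel H.Adj] in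
/-- The pebble pairs of the extended tuples lie in the extended position. -/
theorem range_snoc_subset (a w : V) (b x : W) :
    (Set.range fun i : Fin 2 => ((Fin.snoc (fun _ : Fin 1 => a) w : Fin 2 → V) i, (Fin.snoc (fun _ : Fin 1 => b) x : Fin 2 → W) i)) ⊆
      insert (w, x) ({(a, b)} : Set (V × W)) := by
  rintro _ ⟨i, rfl⟩
  fin_cases i
  · exact Set.mem_insert_of_mem _ (by rw [Set.mem_singleton_iff]; rfl)
  · exact Set.mem_insert _ _

/-- **Singly pebbled pairs have equal refinement colours at every round** along a colour-respecting bijective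
`k`-pebble strategy with `k ≥ 2`. -/
theorem wlColourC_eq_of_mem {k : ℕ} (S : BijPebbleStrategy k G H) (hk : 2 ≤ k)
    (hS : ∀ p ∈ S.carrier, ∀ x ∈ p, c x.1 = d x.2) (i : ℕ) :
    ∀ {a : V} {b : W}, ({(a, b)} : Set (V × W)) ∈ S.carrier →
      wlColourC G c i (fun _ : Fin 1 => a) = wlColourC H d i (fun _ : Fin 1 => b) := by
  induction i with
  | zero =>
    intro a b h
    rw [wlColourC_zero, wlColourC_zero]
    refine Prod.ext ?_ ?_
    · funext x y
      simp [atpC, atp]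
    · funext x
      exact hS _ h (a, b) rfl
  | succ i ih =>
    intro a b h
    rw [wlColourC_succ, wlColourC_succ]
    refine Prod.ext (ih h) ?_
    have hlt : ({(a, b)} : Set (V × W)).ncard < k := by rw [Set.ncard_singleton]; omega
    obtain ⟨f, hf⟩ := S.forth h hlt
    have key : ∀ w : V,
        (atpC G c (Fin.snoc (fun _ : Fin 1 => a) w : Fin 2 → V), fun j => wlColourC G c i (Function.update (fun _ : Fin 1 => a) j w)) =
          (atpC H d (Fin.snoc (fun _ : Fin 1 => b) (f w) : Fin 2 → W),
            fun j => wlColourC H d i (Function.update (fun _ : Fin 1 => b) j (f w))) := by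
      intro w
      have hp := hf w
      have hpi := S.isPartialIso_of_mem hp
      refine Prod.ext (Prod.ext ?_ ?_) ?_
      · exact (atp_eq_atp_iff _ _).2 (hpi.mono (range_snoc_subset a w b (f w)))
      · funext x
        fin_cases x
        · exact hS _ hp (a, b) (Set.mem_insert_of_mem _ rfl)
        · exact hS _ hp (w, f w) (Set.mem_insert _ _)
      · funext j
        show wlColourC G c i (Function.update (fun _ : Fin 1 => a) j w) = wlColourC H d i (Function.update (fun _ : Fin 1 => b) j (f w))
        rw [update_tup1, update_tup1]
        exact ih (S.mem_of_subset hp (Set.singleton_subset_iff.2 (Set.mem_insert _ _)))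
    calc (univ : Finset V).val.map (fun w => (atpC G c (Fin.snoc (fun _ : Fin 1 => a) w : Fin 2 → V),
            fun j => wlColourC G c i (Function.update (fun _ : Fin 1 => a) j w)))
        = (univ : Finset V).val.map ((fun w' => (atpC H d (Fin.snoc (fun _ : Fin 1 => b) w' : Fin 2 → W),
            fun j => wlColourC H d i (Function.update (fun _ : Fin 1 => b) j w'))) ∘ f) :=
          Multiset.map_congr rfl fun w _ => key w
      _ = ((univ : Finset V).val.map (f : V → W)).map (fun w' => (atpC H d (Fin.snoc (fun _ : Fin 1 => b) w' : Fin 2 → W),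
            fun j => wlColourC H d i (Function.update (fun _ : Fin 1 => b) j w'))) := (Multiset.map_map _ _ _).symm
      _ = (univ : Finset W).val.map (fun w' => (atpC H d (Fin.snoc (fun _ : Fin 1 => b) w' : Fin 2 → W),
            fun j => wlColourC H d i (Function.update (fun _ : Fin 1 => b) j w'))) := by
          have hval : Multiset.map (f : V → W) (univ : Finset V).val = (univ : Finset W).val := by
            rw [← Equiv.coe_toEmbedding, ← Finset.map_val, Finset.map_univ_equiv]
          rw [hval]

/-- **Discrete colour refinement identifies** (folklore; Immerman–Lander 1990): if `(G, c)` and `(H, d)` admit a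
colour-respecting bijective `k`-pebble strategy with `k ≥ 2` and the colour refinement of `(G, c)` is injective on
vertices at some round `T`, then `G ≃g H` (by a colour-preserving isomorphism: the bijection of the empty position). -/
theorem nonempty_iso_of_strategy {k : ℕ} (S : BijPebbleStrategy k G H) (hk : 2 ≤ k)
    (hS : ∀ p ∈ S.carrier, ∀ x ∈ p, c x.1 = d x.2) {T : ℕ}
    (hinj : Function.Injective fun v : V => wlColourC G c T (fun _ : Fin 1 => v)) : Nonempty (G ≃g H) := by
  obtain ⟨f₀, hf₀⟩ := S.forth S.empty_mem (by rw [Set.ncard_empty]; omega)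
  have h₀ : ∀ v : V, ({(v, f₀ v)} : Set (V × W)) ∈ S.carrier := fun v => by
    simpa using hf₀ v
  have hcol : ∀ v : V, wlColourC G c T (fun _ : Fin 1 => v) = wlColourC H d T (fun _ : Fin 1 => f₀ v) := fun v =>
    wlColourC_eq_of_mem S hk hS T (h₀ v)
  refine ⟨⟨f₀, ?_⟩⟩
  intro x y
  -- pebble `x ↦ f₀ x`, then let Duplicator answer `y`
  have hlt : ({(x, f₀ x)} : Set (V × W)).ncard < k := by rw [Set.ncard_singleton]; omega
  obtain ⟨f₁, hf₁⟩ := S.forth (h₀ x) hlt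
  have hp := hf₁ y
  have hpi := S.isPartialIso_of_mem hp
  -- the answer is forced: refined colours are injective on `H` as well
  have hy : f₁ y = f₀ y := by
    have h1 : wlColourC G c T (fun _ : Fin 1 => y) = wlColourC H d T (fun _ : Fin 1 => f₁ y) :=
      wlColourC_eq_of_mem S hk hS T (S.mem_of_subset hp (Set.singleton_subset_iff.2 (Set.mem_insert _ _)))
    set z : V := f₀.symm (f₁ y) with hz
    have hz' : f₁ y = f₀ z := by rw [hz, Equiv.apply_symm_apply]
    have h2 : wlColourC G c T (fun _ : Fin 1 => z) = wlColourC G c T (fun _ : Fin 1 => y) := by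
      rw [hcol z, ← hz', ← h1]
    have := hinj h2
    rw [hz', this]
  have hadj := hpi.adj_iff (Set.mem_insert_of_mem _ rfl) (Set.mem_insert _ _)
  -- `hadj : G.Adj x y ↔ H.Adj (f₀ x) (f₁ y)`
  simp only at hadj
  rw [hy] at hadj
  exact hadj.symm

end CRIdent

/-! ### The entropy-game form -/

namespace CosetGame

open CRIdent

variable {n K : ℕ}

/-- **A low-entropy colouring with discrete colour refinement identifies the graph at the next entropy level**:
if `c : Fin n → ℕ` has entropy `≤ K n`, the colour refinement of `(W, c)` is injective at some round, and
`n / (log₂ n + 1) ≥ 2`, then every `H` with an entropy-`(K+1)` game against `W` is isomorphic to `W`. -/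
theorem nonempty_iso_of_entropyGame_of_discrete {W H : SimpleGraph (Fin n)} [DecidableRel W.Adj] [DecidableRel H.Adj]
    (hn : 2 ≤ 1 * n / (Nat.log 2 n + 1)) (c : Fin n → ℕ) (hc : IsLowEntropy K c) {T : ℕ}
    (hinj : Function.Injective fun v : Fin n => wlColourC W c T (fun _ : Fin 1 => v))
    (g : Nonempty (EntropyGame (K + 1) W H)) : Nonempty (W ≃g H) := by
  obtain ⟨π, S, hS⟩ := colourRobust_of_entropyGame (K₁ := K) (K₂ := 1) g c hc
  exact nonempty_iso_of_strategy (d := fun v => c (π.symm v)) S hn hS hinj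

/-- **TAME certificate** (contrapositive): a colouring of entropy `≤ K n` with discrete colour refinement rules `W`
out as half of a non-isomorphic pair with an entropy-`(K+1)` game. -/
theorem not_nonempty_entropyGame_of_discrete {W H : SimpleGraph (Fin n)} [DecidableRel W.Adj] [DecidableRel H.Adj]
    (hn : 2 ≤ 1 * n / (Nat.log 2 n + 1)) (c : Fin n → ℕ) (hc : IsLowEntropy K c) {T : ℕ}
    (hinj : Function.Injective fun v : Fin n => wlColourC W c T (fun _ : Fin 1 => v))
    (hWH : ¬ Nonempty (W ≃g H)) : ¬ Nonempty (EntropyGame (K + 1) W H) :=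
  fun g => hWH (nonempty_iso_of_entropyGame_of_discrete hn c hc hinj g)

/-- The pebble budget `n / (log₂ n + 1)` is at least `2` once `n ≥ 8`. -/
theorem two_le_div_log (hn : 8 ≤ n) : 2 ≤ 1 * n / (Nat.log 2 n + 1) := by
  rw [one_mul]
  refine (Nat.le_div_iff_mul_le (Nat.succ_pos _)).2 ?_
  -- `2 (log₂ n + 1) ≤ n` for `n ≥ 8`: `log₂ n < k` whenever `n < 2^k`; take `k = n / 2`
  have h4 : 4 ≤ n / 2 := by omega
  have hlt : n < 2 ^ (n / 2) := by
    have key : ∀ m : ℕ, 4 ≤ m → 2 * m + 1 < 2 ^ m := by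
      intro m hm
      induction m, hm using Nat.le_induction with
      | base => norm_num
      | succ m _ ih => rw [pow_succ]; omega
    have := key (n / 2) h4
    omega
  have hlog : Nat.log 2 n < n / 2 := Nat.log_lt_of_lt_pow (by omega) hlt
  omega

/-- **TAME certificate, `n ≥ 8` form.** -/
theorem not_nonempty_entropyGame_of_discrete' {W H : SimpleGraph (Fin n)} [DecidableRel W.Adj] [DecidableRel H.Adj]
    (hn : 8 ≤ n) (c : Fin n → ℕ) (hc : IsLowEntropy K c) {T : ℕ}
    (hinj : Function.Injective fun v : Fin n => wlColourC W c T (fun _ : Fin 1 => v))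
    (hWH : ¬ Nonempty (W ≃g H)) : ¬ Nonempty (EntropyGame (K + 1) W H) :=
  not_nonempty_entropyGame_of_discrete (two_le_div_log hn) c hc hinj hWH

end CosetGame

end Summit.PneNP.PneNP.Theorems
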